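import Mathlib
import Literature.Analysis.Complex.PerronHigherOrder

/-!
# Solo-blind kernel #271 — the source envelope `‖V(σ+iy)‖ ≤ C₀/√(1+y²)` for a difference-quotient source

ENGINE-L-SPEC §13(a): the source vector of the resolvent read-out is a DIFFERENCE QUOTIENT of the
y-datum transform, `V(z) = [k̂_y(0) − k̂_y(z)]/z` (value `−k̂_y′(0)` at `z = 0`).  Kernel #269
(`ResolventReadout.strip_envelope`) turns a resolvent bound `B` on the strip and a source envelope
`‖src(σ+iy)‖ ≤ C₀/√(1+y²)` into the envelope hypothesis `hC` of #267 (`HardyFromDecay`), whence H² and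
the [A′] mass bound (#266).  This file discharges the SOURCE ENVELOPE for any such difference quotient:

* `src F = dslope F 0` (Mathlib's extended difference quotient: `(F s − F 0)/s` for `s ≠ 0`, `F′(0)` at
  `0`; the programme's `V = −src`, same norm);
* `differentiableOn_src` : `F` holomorphic on an open `U ∋ 0` ⇒ `src F` holomorphic on `U` (removable
  singularity) — hypothesis `hsrc` of #269's `differentiableOn_readout`;
* `norm_src_le_far`  : `‖src F s‖ ≤ 2B/‖s‖` from `‖F 0‖, ‖F s‖ ≤ B` (`s ≠ 0`);
* `norm_src_le_near` : `‖src F s‖ ≤ B′` on a convex `U ∋ 0, s` where `‖F′‖ ≤ B′` (mean-value inequality);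
* `strip_source_envelope` : on a strip `a < Re s ≤ b` inside such a `U`,
  `‖src F (σ+iy)‖ ≤ √2(2B + B′)/√(1+y²)` — exactly the `hsrc` hypothesis of #269 with `C₀ = √2(2B+B′)`.
-/

namespace Summit.AnomalousDissipation.SoloBlind.SourceEnvelope

open Complex Set

variable {E : Type*} [NormedAddCommGroup E] [NormedSpace ℂ E]

/-- The difference-quotient source `src F s = (F s − F 0)/s` (`= F′(0)` at `s = 0`). -/
noncomputable def src (F : ℂ → E) : ℂ → E := dslope F 0

/-- Away from `0` the source is the plain difference quotient. -/
theorem src_of_ne_zero (F : ℂ → E) {s : ℂ} (hs : s ≠ 0) : src F s = s⁻¹ • (F s - F 0) := by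
  unfold src
  rw [dslope_of_ne F hs, slope_def_module, sub_zero]

/-- At `0` the source is the derivative. -/
theorem src_zero (F : ℂ → E) : src F 0 = deriv F 0 := by
  unfold src
  exact dslope_same F 0

/-- **Holomorphy** (removable singularity): `F` holomorphic on an open `U ∋ 0` ⇒ `src F` holomorphic on `U`. -/
theorem differentiableOn_src [CompleteSpace E] {F : ℂ → E} {U : Set ℂ} (hU : IsOpen U) (h0 : (0 : ℂ) ∈ U)
    (hF : DifferentiableOn ℂ F U) : DifferentiableOn ℂ (src F) U :=
  (Complex.differentiableOn_dslope (hU.mem_nhds h0)).2 hF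

/-- **Far bound**: `‖src F s‖ ≤ 2B/‖s‖` for `s ≠ 0`. -/
theorem norm_src_le_far {F : ℂ → E} {B : ℝ} {s : ℂ} (hs : s ≠ 0) (h0 : ‖F 0‖ ≤ B)
    (hFs : ‖F s‖ ≤ B) : ‖src F s‖ ≤ 2 * B / ‖s‖ := by
  rw [src_of_ne_zero F hs, norm_smul, norm_inv]
  have hspos : 0 < ‖s‖ := norm_pos_iff.2 hs
  calc ‖s‖⁻¹ * ‖F s - F 0‖ ≤ ‖s‖⁻¹ * (B + B) := by
        gcongr
        exact (norm_sub_le _ _).trans (add_le_add hFs h0)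
    _ = 2 * B / ‖s‖ := by rw [div_eq_inv_mul]; ring

/-- **Near bound** (mean-value inequality): on a convex `U ∋ 0` with `‖F′‖ ≤ B′`, `‖src F s‖ ≤ B′`
for every `s ∈ U`. -/
theorem norm_src_le_near {F : ℂ → E} {U : Set ℂ} {B' : ℝ} (hU : Convex ℝ U)
    (hd : ∀ z ∈ U, DifferentiableAt ℂ F z) (hB' : ∀ z ∈ U, ‖deriv F z‖ ≤ B') (h0 : (0 : ℂ) ∈ U)
    {s : ℂ} (hs : s ∈ U) : ‖src F s‖ ≤ B' := by
  by_cases hs0 : s = 0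
  · subst hs0; rw [src_zero]; exact hB' 0 h0
  · rw [src_of_ne_zero F hs0, norm_smul, norm_inv]
    have hspos : 0 < ‖s‖ := norm_pos_iff.2 hs0
    have hmv : ‖F s - F 0‖ ≤ B' * ‖s - 0‖ :=
      hU.norm_image_sub_le_of_norm_deriv_le hd hB' h0 hs
    rw [sub_zero] at hmv
    calc ‖s‖⁻¹ * ‖F s - F 0‖ ≤ ‖s‖⁻¹ * (B' * ‖s‖) := by gcongr
      _ = B' := by field_simp

/-- Elementary: `√(1+y²) ≤ √2 · |y|` for `|y| ≥ 1`. -/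
theorem sqrt_one_add_sq_le {y : ℝ} (hy : 1 ≤ |y|) : Real.sqrt (1 + y ^ 2) ≤ Real.sqrt 2 * |y| := by
  have h2 : Real.sqrt 2 * |y| = Real.sqrt (2 * y ^ 2) := by
    rw [Real.sqrt_mul (by norm_num : (0:ℝ) ≤ 2), Real.sqrt_sq_eq_abs]
  rw [h2]
  apply Real.sqrt_le_sqrt
  have : 1 ≤ y ^ 2 := by
    calc (1 : ℝ) = 1 ^ 2 := by norm_num
      _ ≤ |y| ^ 2 := by gcongr
      _ = y ^ 2 := sq_abs y
  linarith

/-- Elementary: `√(1+y²) ≤ √2` for `|y| ≤ 1`. -/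
theorem sqrt_one_add_sq_le' {y : ℝ} (hy : |y| ≤ 1) : Real.sqrt (1 + y ^ 2) ≤ Real.sqrt 2 := by
  apply Real.sqrt_le_sqrt
  have : y ^ 2 ≤ 1 := by
    calc y ^ 2 = |y| ^ 2 := (sq_abs y).symm
      _ ≤ 1 ^ 2 := by gcongr
      _ = 1 := by norm_num
  linarith

/-- **The strip source envelope.**  Let `U` be open and convex with `0 ∈ U`, containing the strip
`{σ+iy : a < σ ≤ b}`; let `F` be holomorphic on `U` with `‖F‖ ≤ B` and `‖F′‖ ≤ B′` there.  Then for
`a < σ ≤ b` and all real `y`: `‖src F (σ+iy)‖ ≤ √2(2B + B′)/√(1+y²)` — the hypothesis `hsrc` of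
#269 `strip_envelope` with `C₀ = √2(2B+B′)`. -/
theorem strip_source_envelope {F : ℂ → E} {U : Set ℂ} {a b B B' : ℝ} (hUo : IsOpen U)
    (hUc : Convex ℝ U) (h0 : (0 : ℂ) ∈ U)
    (hstrip : ∀ σ y : ℝ, a < σ → σ ≤ b → (σ : ℂ) + y * I ∈ U)
    (hF : DifferentiableOn ℂ F U) (hB : ∀ z ∈ U, ‖F z‖ ≤ B) (hB' : ∀ z ∈ U, ‖deriv F z‖ ≤ B') :
    ∀ σ y : ℝ, a < σ → σ ≤ b →
      ‖src F ((σ : ℂ) + y * I)‖ ≤ Real.sqrt 2 * (2 * B + B') / Real.sqrt (1 + y ^ 2) := by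
  intro σ y ha hb
  have hd : ∀ z ∈ U, DifferentiableAt ℂ F z := fun z hz => hF.differentiableAt (hUo.mem_nhds hz)
  have hsU := hstrip σ y ha hb
  have hBnn : 0 ≤ B := (norm_nonneg _).trans (hB 0 h0)
  have hB'nn : 0 ≤ B' := (norm_nonneg _).trans (hB' 0 h0)
  have hsq : 0 < Real.sqrt (1 + y ^ 2) := Real.sqrt_pos.2 (by positivity)
  have hsqrt2 : 0 < Real.sqrt 2 := Real.sqrt_pos.2 (by norm_num)
  rw [le_div_iff₀ hsq]
  by_cases hy : 1 ≤ |y|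
  · -- far regime: ‖s‖ ≥ |y| ≥ √(1+y²)/√2
    have hs0 : ((σ : ℂ) + y * I) ≠ 0 := by
      intro h
      have : |y| ≤ 0 := by simpa [h] using Literature.Analysis.Complex.abs_im_le_norm_line σ y
      linarith
    have hfar := norm_src_le_far hs0 (hB 0 h0) (hB _ hsU)
    have hnorm : Real.sqrt (1 + y ^ 2) ≤ Real.sqrt 2 * ‖(σ : ℂ) + y * I‖ :=
      (sqrt_one_add_sq_le hy).trans (by gcongr; exact Literature.Analysis.Complex.abs_im_le_norm_line σ y)
    have hspos : 0 < ‖(σ : ℂ) + y * I‖ := norm_pos_iff.2 hs0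
    calc ‖src F ((σ : ℂ) + y * I)‖ * Real.sqrt (1 + y ^ 2)
        ≤ (2 * B / ‖(σ : ℂ) + y * I‖) * (Real.sqrt 2 * ‖(σ : ℂ) + y * I‖) :=
          mul_le_mul hfar hnorm hsq.le (div_nonneg (by linarith) hspos.le)
      _ = Real.sqrt 2 * (2 * B) := by field_simp
      _ ≤ Real.sqrt 2 * (2 * B + B') := by gcongr; linarith
  · -- near regime: √(1+y²) ≤ √2 and ‖src‖ ≤ B′
    push Not at hy
    have hnear := norm_src_le_near hUc hd hB' h0 hsU
    calc ‖src F ((σ : ℂ) + y * I)‖ * Real.sqrt (1 + y ^ 2) ≤ B' * Real.sqrt 2 :=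
          mul_le_mul hnear (sqrt_one_add_sq_le' hy.le) hsq.le hB'nn
      _ ≤ Real.sqrt 2 * (2 * B + B') := by nlinarith

end Summit.AnomalousDissipation.SoloBlind.SourceEnvelope
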